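import Summits.SmoothPoincare4.SmoothPoincare4.Theorems.CongruenceShadowsGriffithsHandlebodyExtensionCoverCharts
import Literature.Topology.FourManifolds.RoundSolidTorusSolidTwist
import HarnessLib

/-!
# SmoothPoincare4 / CongruenceShadows — `GriffithsHandlebodyExtension` (item stmt-SmoothPoincare4-15190): the covering map `H³ ∖ 0 → V` (E1)

Support file (`--supports` stmt-SmoothPoincare4-15190) of the homothety-cover proof of the genus-one
clause (E) of Griffiths' handlebody extension theorem — *every self-diffeomorphism of the Heegaard torus
`∂V` of the round solid torus fixing the base point and acting trivially on `π₁(∂V)` extends to a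
self-diffeomorphism of `V`* (hypothesis `hE` of
`Literature.Topology.FourManifolds.RoundSolidTorusModel.diffeoExtends_of_map_ker_eq_ker_of_forall_diffeoExtends`).
See the module docstring of `…CoverDefs` for the whole line (E1–E6) and the notation
(`τ̂`, `δ_λ`, `ρ`, `χ`, `f`, `Δ^(c)`, `α`, `L`, `M`, `Ψ̂`, `ẽ_c`).

This part (E1): the explicit covering map `covMap : ℝ² × ℝ → ℝ³` of the round solid torus `V = {G ≤ 0}` by the punctured
closed upper half-space — longitude `exp (2πi · log (rad p) / log λ)`, meridian coordinate the stereographic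
coordinate of `α⁻¹ p` — its invariance under the deck homothety, the fibre description
(`covMap p = covMap q ↔ q = λⁿ p`), smoothness, and the smooth local sections `secMap`.
-/

-- the registered namespace `Summit.SmoothPoincare4.SmoothPoincare4.Theorems` repeats a component
set_option linter.dupNamespace false

noncomputable section

namespace Summit.SmoothPoincare4.SmoothPoincare4.Theorems

namespace HomothetyCover

open Set Function Metric Filter
open scoped Topology ContDiff

section CoverMap

open Literature.Topology.FourManifolds Literature.Topology.FourManifolds.RoundSolidTorusModel
open Complex (I)

/-- `‖w‖² = w₀² + w₁²` in the Euclidean plane. -/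
theorem norm_sq_snd_eq (w : E2) : ‖w‖ ^ 2 = w 0 ^ 2 + w 1 ^ 2 := by
  rw [EuclideanSpace.norm_sq_eq, Fin.sum_univ_two, Real.norm_eq_abs, Real.norm_eq_abs, sq_abs, sq_abs]

variable (lam : ℝ)

/-- `κ = 2π / log λ`: one deck homothety is one full turn of the longitude. -/
def kap : ℝ := 2 * Real.pi / Real.log lam

/-- The longitude angle `ℓ(p) = κ log ‖p‖` of a point of `H³ ∖ 0`. -/
def lng (p : E2 × ℝ) : ℝ := kap lam * Real.log (rad p)

/-- The longitude unit complex number `e^{iℓ(p)}`. -/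
def lngC (p : E2 × ℝ) : ℂ := Complex.exp ((lng lam p : ℂ) * I)

/-- The meridian number `w₀ + i w₁` of a point, `w = (αinv p).2` its stereographic coordinate. -/
def merW (p : E2 × ℝ) : ℂ := (((αinv p).2 0 : ℝ) : ℂ) + (((αinv p).2 1 : ℝ) : ℂ) * I

/-- **The covering map** `P : ℝ² × ℝ → ℝ³`, `P(p) = ptOf e^{iℓ(p)} (w₀ + i w₁)`: the point of
`ℝ³` with longitude `κ log ‖p‖` and meridian-disc coordinate the stereographic coordinate of
`p/‖p‖`.  On `H³ ∖ 0` it is the universal covering of the round solid torus `V`, with deck group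
the homotheties `δ_λ^ℤ`. -/
def covMap (p : E2 × ℝ) : EuclideanSpace ℝ (Fin 3) := ptOf (lngC lam p) (merW p)

/-- The stereographic (meridian-disc) coordinate of a point of `ℝ³` near `V`:
`(x² + y² − 4, 4z)`. -/
def wOf (v : EuclideanSpace ℝ (Fin 3)) : E2 := !₂[(merC v).re, (merC v).im]

/-- First coordinate of `wOf v`: the real part of the meridian coordinate `merC v`. -/
@[simp] theorem wOf_apply_zero (v : EuclideanSpace ℝ (Fin 3)) : wOf v 0 = (merC v).re := by simp [wOf]

/-- Second coordinate of `wOf v`: the imaginary part of the meridian coordinate `merC v`. -/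
@[simp] theorem wOf_apply_one (v : EuclideanSpace ℝ (Fin 3)) : wOf v 1 = (merC v).im := by simp [wOf]

/-- `‖wOf v‖² = G v + 1`: the meridian disc coordinate has norm `≤ 1` exactly on the solid torus `{G ≤ 0}`. -/
theorem norm_sq_wOf (v : EuclideanSpace ℝ (Fin 3)) : ‖wOf v‖ ^ 2 = G v + 1 := by
  rw [norm_sq_snd_eq, wOf_apply_zero, wOf_apply_one, G_eq_normSq_merC, Complex.normSq_apply]; ring

/-- A branch of the longitude angle near the ray of angle `φ₀`: `φ₀ + arg (longC v · e^{−iφ₀})`. -/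
def angAt (φ₀ : ℝ) (v : EuclideanSpace ℝ (Fin 3)) : ℝ :=
  φ₀ + Complex.arg (longC v * Complex.exp (-((φ₀ : ℂ) * I)))

/-- **The local section** `S_{φ₀}(v) = α (exp (angAt φ₀ v / κ), wOf v)` of `P`, smooth off the
half-plane of longitude `φ₀ + π`; `S_0` is the principal (global, discontinuous) section. -/
def secMap (φ₀ : ℝ) (v : EuclideanSpace ℝ (Fin 3)) : E2 × ℝ :=
  α (Real.exp (angAt φ₀ v / kap lam), wOf v)

variable {lam}

/-- The longitude phase `lngC` is unimodular. -/
theorem normSq_lngC (p : E2 × ℝ) : Complex.normSq (lngC lam p) = 1 := by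
  rw [lngC, Complex.normSq_eq_norm_sq, Complex.norm_exp_ofReal_mul_I, one_pow]

/-- Real part of the meridian coordinate `merW p`: the first stereographic coordinate. -/
theorem merW_re (p : E2 × ℝ) : (merW p).re = (αinv p).2 0 := by simp [merW]

/-- Imaginary part of the meridian coordinate `merW p`: the second stereographic coordinate. -/
theorem merW_im (p : E2 × ℝ) : (merW p).im = (αinv p).2 1 := by simp [merW]

/-- `|merW p|² = ‖(α⁻¹ p).2‖²`. -/
theorem normSq_merW (p : E2 × ℝ) : Complex.normSq (merW p) = ‖(αinv p).2‖ ^ 2 := by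
  rw [Complex.normSq_apply, merW_re, merW_im, norm_sq_snd_eq]; ring

/-- Each coordinate is bounded by the Euclidean norm. -/
theorem abs_apply_le_norm (w : E2) (i : Fin 2) : |w i| ≤ ‖w‖ := by
  have h := norm_sq_snd_eq w
  have h0 : 0 ≤ ‖w‖ := norm_nonneg w
  have hi : w i ^ 2 ≤ ‖w‖ ^ 2 := by
    rw [h]
    fin_cases i
    · show w 0 ^ 2 ≤ w 0 ^ 2 + w 1 ^ 2; nlinarith [sq_nonneg (w 1)]
    · show w 1 ^ 2 ≤ w 0 ^ 2 + w 1 ^ 2; nlinarith [sq_nonneg (w 0)]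
  calc |w i| = Real.sqrt (w i ^ 2) := (Real.sqrt_sq_eq_abs _).symm
    _ ≤ Real.sqrt (‖w‖ ^ 2) := Real.sqrt_le_sqrt hi
    _ = ‖w‖ := Real.sqrt_sq h0

/-- On `{‖w‖ ≤ 1}` (the closed upper half-space) `4 + w₀ ≥ 3 > 0`. -/
theorem four_add_merW_re_pos {p : E2 × ℝ} (hp : p ∈ Hpunct) : 0 < 4 + 1 * (merW p).re := by
  rw [merW_re]
  have h := abs_apply_le_norm (αinv p).2 0
  have h1 := norm_αinv_snd_le_one hp
  have := neg_abs_le ((αinv p).2 0)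
  linarith

/-- `G ∘ P = ‖w‖² − 1`: `P` maps `H³ ∖ 0` into `V = {G ≤ 0}`, the boundary plane onto `∂V`. -/
theorem G_covMap {p : E2 × ℝ} (hp : p ∈ Hpunct) : G (covMap lam p) = ‖(αinv p).2‖ ^ 2 - 1 := by
  rw [G_eq_normSq_merC, covMap, merC_ptOf (normSq_lngC p) (four_add_merW_re_pos hp).le, normSq_merW]

/-- The covering map takes the punctured closed upper half-space into the solid torus `{G ≤ 0}`. -/
theorem G_covMap_nonpos {p : E2 × ℝ} (hp : p ∈ Hpunct) : G (covMap lam p) ≤ 0 := by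
  rw [G_covMap hp]
  have h1 := norm_αinv_snd_le_one hp
  nlinarith [norm_nonneg (αinv p).2]

/-- The covering map takes the punctured closed upper half-space into `{fn ≤ 0}`. -/
theorem fn_covMap_nonpos {p : E2 × ℝ} (hp : p ∈ Hpunct) : fn (covMap lam p) ≤ 0 :=
  (fn_nonpos_iff _).2 (G_covMap_nonpos hp)

/-- The covering map takes the punctured boundary plane to the boundary torus `{G = 0}`. -/
theorem G_covMap_boundary {y : E2} (hy : y ≠ 0) : G (covMap lam (y, 0)) = 0 := by
  have hp : ((y, (0 : ℝ)) : E2 × ℝ) ∈ Hpunct := ⟨le_rfl, fun h => hy (congrArg Prod.fst h)⟩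
  rw [G_covMap hp, norm_αinv_snd_eq_one hy]; ring

/-- A point of `H³ ∖ 0` over `∂V` lies in the boundary plane. -/
theorem snd_eq_zero_of_G_covMap {p : E2 × ℝ} (hp : p ∈ Hpunct) (h : G (covMap lam p) = 0) :
    p.2 = 0 := by
  have hσ := rad_add_snd_pos hp
  rw [G_covMap hp, norm_sq_αinv_snd p hσ] at h
  have : (rad p - p.2) = (rad p + p.2) := by
    field_simp at h
    linarith
  linarith

/-- Longitude of the covering map: `longC (covMap p) = lngC p`. -/
theorem longC_covMap {p : E2 × ℝ} (hp : p ∈ Hpunct) : longC (covMap lam p) = lngC lam p :=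
  longC_ptOf (normSq_lngC p) (four_add_merW_re_pos hp)

/-- Meridian coordinate of the covering map: `merC (covMap p) = merW p`. -/
theorem merC_covMap {p : E2 × ℝ} (hp : p ∈ Hpunct) : merC (covMap lam p) = merW p :=
  merC_ptOf (normSq_lngC p) (four_add_merW_re_pos hp).le

/-- `κ · log λ = 2π`: one deck homothety is one full turn of the longitude. -/
theorem kap_mul_log (hlam : 1 < lam) : kap lam * Real.log lam = 2 * Real.pi := by
  have : Real.log lam ≠ 0 := (Real.log_pos hlam).ne'
  rw [kap, div_mul_cancel₀ _ this]

/-- `κ ≠ 0`. -/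
theorem kap_ne_zero (hlam : 1 < lam) : kap lam ≠ 0 := by
  have := kap_mul_log hlam
  intro h; rw [h, zero_mul] at this; linarith [Real.pi_pos]

/-- `P` is invariant under the deck homothety. -/
theorem covMap_smul (hlam : 1 < lam) {p : E2 × ℝ} (hp : p ∈ Hpunct) :
    covMap lam (lam • p) = covMap lam p := by
  have hl : 0 < lam := lt_trans zero_lt_one hlam
  have hσ := rad_add_snd_pos hp
  have hr := rad_pos hp.2
  have hw : (αinv (lam • p)).2 = (αinv p).2 := by rw [αinv_smul hl hσ]
  have hU : lngC lam (lam • p) = lngC lam p := by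
    rw [lngC, lngC, lng, lng, rad_smul hl, Real.log_mul hl.ne' hr.ne', mul_add, kap_mul_log hlam]
    rw [Complex.ofReal_add, add_mul, Complex.exp_add]
    have : Complex.exp (((2 * Real.pi : ℝ) : ℂ) * I) = 1 := by
      rw [show ((2 * Real.pi : ℝ) : ℂ) * I = 2 * Real.pi * I by push_cast; ring]
      exact Complex.exp_two_pi_mul_I
    rw [this, one_mul]
  have hW : merW (lam • p) = merW p := by rw [merW, merW, hw]
  rw [covMap, covMap, hU, hW]

/-- The covering map is invariant under all integer powers of the deck homothety. -/
theorem covMap_zpow_smul (hlam : 1 < lam) (n : ℤ) {p : E2 × ℝ} (hp : p ∈ Hpunct) :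
    covMap lam (lam ^ n • p) = covMap lam p := by
  have hl : 0 < lam := lt_trans zero_lt_one hlam
  induction n generalizing p with
  | zero => simp
  | succ n ih =>
    rw [zpow_add_one₀ hl.ne', mul_comm, mul_smul, covMap_smul hlam (smul_mem_Hpunct (zpow_pos hl n) hp),
      ih hp]
  | pred n ih =>
    have hp' : lam⁻¹ • p ∈ Hpunct := smul_mem_Hpunct (inv_pos.2 hl) hp
    rw [zpow_sub_one₀ hl.ne', mul_smul, ih hp', ← covMap_smul hlam hp', smul_smul,
      mul_inv_cancel₀ hl.ne', one_smul]

/-- **The fibres of `P` on `H³ ∖ 0` are the deck orbits.** -/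
theorem exists_zpow_smul_of_covMap_eq (hlam : 1 < lam) {p q : E2 × ℝ} (hp : p ∈ Hpunct)
    (hq : q ∈ Hpunct) (h : covMap lam p = covMap lam q) : ∃ n : ℤ, p = lam ^ n • q := by
  have hl : 0 < lam := lt_trans zero_lt_one hlam
  have hlog : 0 < Real.log lam := Real.log_pos hlam
  -- equal meridian numbers
  have hW : merW p = merW q := by rw [← merC_covMap hp, ← merC_covMap hq, h]
  have hw : (αinv p).2 = (αinv q).2 := by
    ext i
    fin_cases i
    · have := congrArg Complex.re hW; simpa [merW_re] using this
    · have := congrArg Complex.im hW; simpa [merW_im] using this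
  -- equal longitude units: the angles differ by a multiple of `2π`
  have hU : lngC lam p = lngC lam q := by rw [← longC_covMap hp, ← longC_covMap hq, h]
  obtain ⟨n, hn⟩ := Complex.exp_eq_exp_iff_exists_int.1 hU
  have hℓ : lng lam p = lng lam q + n * (2 * Real.pi) := by
    have h1 : ((lng lam p : ℝ) : ℂ) * I = ((lng lam q + n * (2 * Real.pi) : ℝ) : ℂ) * I := by
      rw [hn]; push_cast; ring
    have h2 := mul_right_cancel₀ Complex.I_ne_zero h1
    exact_mod_cast h2
  -- hence the radii differ by `λ^n`
  have hrp := rad_pos hp.2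
  have hrq := rad_pos hq.2
  have hlogr : Real.log (rad p) = Real.log (rad q) + n * Real.log lam := by
    have hk := kap_ne_zero hlam
    have e : kap lam * Real.log (rad p) = kap lam * (Real.log (rad q) + n * Real.log lam) := by
      rw [mul_add, show kap lam * (n * Real.log lam) = n * (kap lam * Real.log lam) by ring,
        kap_mul_log hlam]
      exact hℓ
    exact mul_left_cancel₀ hk e
  have hr : rad p = lam ^ n * rad q := by
    have e1 : rad p = Real.exp (Real.log (rad p)) := (Real.exp_log hrp).symm
    rw [e1, hlogr, Real.exp_add, Real.exp_log hrq, mul_comm]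
    congr 1
    rw [show (n : ℝ) * Real.log lam = Real.log lam * n by ring, ← Real.rpow_def_of_pos hl,
      Real.rpow_intCast]
  refine ⟨n, ?_⟩
  rw [← α_αinv (rad_add_snd_pos hp), ← α_αinv (rad_add_snd_pos hq)]
  change α (rad p, (αinv p).2) = lam ^ n • α (rad q, (αinv q).2)
  rw [hr, hw, α_mul_left]

/-- `P` is smooth at every point of `H³ ∖ 0`. -/
theorem contDiffAt_covMap {p : E2 × ℝ} (hp : p ∈ Hpunct) :
    ContDiffAt ℝ ∞ (covMap lam) p := by
  have hσ := rad_add_snd_pos hp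
  have hr := rad_pos hp.2
  have hαinv : ContDiffAt ℝ ∞ αinv p := contDiffAt_αinv hp.2 hσ
  have hw : ContDiffAt ℝ ∞ (fun p => (αinv p).2) p := contDiffAt_snd.comp p hαinv
  have hw0 : ContDiffAt ℝ ∞ (fun p => (αinv p).2 0) p :=
    (EuclideanSpace.proj (𝕜 := ℝ) (0 : Fin 2)).contDiff.contDiffAt.comp p hw
  have hw1 : ContDiffAt ℝ ∞ (fun p => (αinv p).2 1) p :=
    (EuclideanSpace.proj (𝕜 := ℝ) (1 : Fin 2)).contDiff.contDiffAt.comp p hw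
  have hℓ : ContDiffAt ℝ ∞ (lng lam) p :=
    contDiffAt_const.mul ((contDiffAt_rad hp.2).log hr.ne')
  have hU : ContDiffAt ℝ ∞ (lngC lam) p := by
    have h1 : ContDiffAt ℝ ∞ (fun p => ((lng lam p : ℝ) : ℂ) * I) p :=
      (Complex.ofRealCLM.contDiff.contDiffAt.comp p hℓ).mul contDiffAt_const
    exact (Complex.contDiff_exp (𝕜 := ℝ)).contDiffAt.comp p h1
  have hW : ContDiffAt ℝ ∞ merW p := by
    refine (Complex.ofRealCLM.contDiff.contDiffAt.comp p hw0).add ?_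
    exact (Complex.ofRealCLM.contDiff.contDiffAt.comp p hw1).mul contDiffAt_const
  have hUre : ContDiffAt ℝ ∞ (fun p => (lngC lam p).re) p := Complex.reCLM.contDiff.contDiffAt.comp p hU
  have hUim : ContDiffAt ℝ ∞ (fun p => (lngC lam p).im) p := Complex.imCLM.contDiff.contDiffAt.comp p hU
  have hWre : ContDiffAt ℝ ∞ (fun p => (merW p).re) p := Complex.reCLM.contDiff.contDiffAt.comp p hW
  have hWim : ContDiffAt ℝ ∞ (fun p => (merW p).im) p := Complex.imCLM.contDiff.contDiffAt.comp p hW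
  have hpos : 4 + 1 * (merW p).re ≠ 0 := (four_add_merW_re_pos hp).ne'
  have hsqrt : ContDiffAt ℝ ∞ (fun p => √(4 + 1 * (merW p).re)) p :=
    (contDiffAt_const.add (contDiffAt_const.mul hWre)).sqrt hpos
  rw [contDiffAt_euclidean]
  intro i
  fin_cases i
  · simp only [covMap, ptOf_apply_zero, Fin.zero_eta]
    exact hsqrt.mul hUre
  · simp only [covMap, ptOf_apply_one, Fin.mk_one]
    exact hsqrt.mul hUim
  · simp only [covMap, ptOf_apply_two, Fin.reduceFinMk]
    exact contDiffAt_const.mul hWim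

/-! #### Local sections -/

/-- The local angle `angAt φ₀ v` is an argument of the longitude phase: `exp (i · angAt φ₀ v) = longC v`. -/
theorem exp_angAt_mul_I {v : EuclideanSpace ℝ (Fin 3)} (hv : 0 < v 0 ^ 2 + v 1 ^ 2) (φ₀ : ℝ) :
    Complex.exp ((angAt φ₀ v : ℂ) * I) = longC v := by
  have hl : Complex.normSq (longC v) = 1 := normSq_longC hv
  have hn : ‖longC v * Complex.exp (-((φ₀ : ℂ) * I))‖ = 1 := by
    rw [norm_mul, show -((φ₀ : ℂ) * I) = ((-φ₀ : ℝ) : ℂ) * I by push_cast; ring,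
      Complex.norm_exp_ofReal_mul_I, mul_one, ← Complex.sq_norm, ] at *
    nlinarith [norm_nonneg (longC v), hl]
  have key := Complex.norm_mul_exp_arg_mul_I (longC v * Complex.exp (-((φ₀ : ℂ) * I)))
  rw [hn, Complex.ofReal_one, one_mul] at key
  rw [angAt, Complex.ofReal_add, add_mul, Complex.exp_add, key, mul_left_comm, ← Complex.exp_add,
    show (φ₀ : ℂ) * I + -((φ₀ : ℂ) * I) = 0 by ring, Complex.exp_zero, mul_one]

/-- `S_{φ₀}` is a section of `P` off the `z`-axis: `P (S_{φ₀} v) = v`. -/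
theorem covMap_secMap (hlam : 1 < lam) (φ₀ : ℝ) {v : EuclideanSpace ℝ (Fin 3)}
    (hv : 0 < v 0 ^ 2 + v 1 ^ 2) : covMap lam (secMap lam φ₀ v) = v := by
  have hR : 0 < Real.exp (angAt φ₀ v / kap lam) := Real.exp_pos _
  have hαinv : αinv (secMap lam φ₀ v) = (Real.exp (angAt φ₀ v / kap lam), wOf v) := αinv_α hR _
  have hU : lngC lam (secMap lam φ₀ v) = longC v := by
    rw [lngC, lng, show rad (secMap lam φ₀ v) = (αinv (secMap lam φ₀ v)).1 from rfl, hαinv]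
    simp only
    rw [Real.log_exp, mul_div_cancel₀ _ (kap_ne_zero hlam), exp_angAt_mul_I hv]
  have hW : merW (secMap lam φ₀ v) = merC v := by
    rw [merW, hαinv]
    apply Complex.ext <;> simp
  rw [covMap, hU, hW, ptOf_longC_merC hv]

/-- `S_{φ₀}` maps `V = {G ≤ 0}` into `H³ ∖ 0`. -/
theorem secMap_mem {v : EuclideanSpace ℝ (Fin 3)} (hv : G v ≤ 0) (φ₀ : ℝ) :
    secMap lam φ₀ v ∈ Hpunct := by
  apply α_mem_Hpunct (Real.exp_pos _)
  have h := norm_sq_wOf v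
  nlinarith [norm_nonneg (wOf v)]

/-- `S_{φ₀}` is smooth at the points whose longitude is not opposite to `φ₀`, in particular at
every point `v` off the `z`-axis for `φ₀ = arg (longC v)`. -/
theorem contDiffAt_secMap {v : EuclideanSpace ℝ (Fin 3)} (hv : 0 < v 0 ^ 2 + v 1 ^ 2) {φ₀ : ℝ}
    (hs : longC v * Complex.exp (-((φ₀ : ℂ) * I)) ∈ Complex.slitPlane) :
    ContDiffAt ℝ ∞ (secMap lam φ₀) v := by
  have hL : ContDiffAt ℝ ∞ (fun v => longC v * Complex.exp (-((φ₀ : ℂ) * I))) v :=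
    (contDiffAt_longC hv).mul contDiffAt_const
  have harg : ContDiffAt ℝ ∞ (fun v => Complex.arg (longC v * Complex.exp (-((φ₀ : ℂ) * I)))) v := by
    have h1 : ContDiffAt ℝ ∞ (fun z : ℂ => (Complex.log z).im) (longC v * Complex.exp (-((φ₀ : ℂ) * I))) :=
      Complex.imCLM.contDiff.contDiffAt.comp _ ((Complex.contDiffAt_log hs).restrict_scalars ℝ)
    have h2 := h1.comp v hL
    refine h2.congr_of_eventuallyEq (Filter.Eventually.of_forall fun y => ?_)
    simp [Complex.log_im]
  have hang : ContDiffAt ℝ ∞ (angAt φ₀) v := contDiffAt_const.add harg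
  have hR : ContDiffAt ℝ ∞ (fun v => Real.exp (angAt φ₀ v / kap lam)) v :=
    Real.contDiff_exp.contDiffAt.comp v (hang.div_const _)
  have hw : ContDiffAt ℝ ∞ wOf v := by
    rw [contDiffAt_euclidean]
    intro i
    fin_cases i
    · simp only [wOf_apply_zero, Fin.zero_eta]
      exact Complex.reCLM.contDiff.contDiffAt.comp v contDiff_merC.contDiffAt
    · simp only [wOf_apply_one, Fin.mk_one]
      exact Complex.imCLM.contDiff.contDiffAt.comp v contDiff_merC.contDiffAt
  exact contDiff_α.contDiffAt.comp v (hR.prodMk hw)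

/-- At `φ₀ = arg (longC v)` the branch condition holds: `longC v · e^{−iφ₀} = 1 ∈ slitPlane`. -/
theorem slitPlane_self {v : EuclideanSpace ℝ (Fin 3)} (hv : 0 < v 0 ^ 2 + v 1 ^ 2) :
    longC v * Complex.exp (-(((Complex.arg (longC v) : ℝ) : ℂ) * I)) ∈ Complex.slitPlane := by
  have hl : Complex.normSq (longC v) = 1 := normSq_longC hv
  have hn : ‖longC v‖ = 1 := by
    rw [Complex.normSq_eq_norm_sq] at hl; nlinarith [norm_nonneg (longC v)]
  have key := Complex.norm_mul_exp_arg_mul_I (longC v)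
  rw [hn, Complex.ofReal_one, one_mul] at key
  have e : Complex.exp (((Complex.arg (longC v) : ℝ) : ℂ) * I) *
      Complex.exp (-(((Complex.arg (longC v) : ℝ) : ℂ) * I)) = 1 := by
    rw [← Complex.exp_add, add_neg_cancel, Complex.exp_zero]
  have : longC v * Complex.exp (-(((Complex.arg (longC v) : ℝ) : ℂ) * I)) = 1 := by
    calc longC v * Complex.exp (-(((Complex.arg (longC v) : ℝ) : ℂ) * I))
        = Complex.exp (((Complex.arg (longC v) : ℝ) : ℂ) * I) *
            Complex.exp (-(((Complex.arg (longC v) : ℝ) : ℂ) * I)) := by rw [key]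
      _ = 1 := e
  rw [this]
  exact Complex.one_mem_slitPlane

end CoverMap

end HomothetyCover

end Summit.SmoothPoincare4.SmoothPoincare4.Theorems

end
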